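import Literature.NumberTheory.Sieve.FGKMT2018DkBoxClasses
import Literature.NumberTheory.Sieve.FGKMT2018Prop91MainTermL84
import HarnessLib

/-!
# Maynard's Proposition 9.4: the root count `ω⁺(p)` of the extended system `(L₀, 𝓛)`

Source: J. Maynard, *Dense clusters of primes in subsets*, Compositio Math. 152 (2016) =
arXiv:1405.2593 [Maynard2016DenseClusters], proof of Proposition 9.4 p. 26 (the count of `n` in
residue classes for the `k+1` forms `L₀ = L, L₁, …, L_k` and the factor `Δ_L/φ(Δ_L)`); K. Ford, B. Green,
S. Konyagin, J. Maynard, T. Tao, *Long gaps between primes*, JAMS 31 (2018), Thm 6 (7.14) p. 22.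

For the class count of the majorant in the proof of Prop. 9.4 one applies the local class count
(`abs_card_dyadZ_localSystem_sub_le`) to the EXTENDED family `L⁺ = Fin.cons L₀ 𝓛` of `k+1` forms with the
same modulus `W`; its main term carries `φ_{ω⁺}(W) = ∏_{p∣W}(p − ω⁺(p))`, `ω⁺ = ω_{L⁺}`. This file computes
`ω⁺`: `ω(p) ≤ ω⁺(p)` always (`omegaL_le_omegaL_cons`), and `ω⁺(p) = ω(p) + 1` at primes
`p ∤ Δ_L = |a₀| ∏_j |a₀b_j − a_jb₀|` (`omegaL_cons_eq_succ`: `L₀` has exactly one root mod `p`, which is not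
a root of any `L_j`). Consequently `φ_{ω⁺}(W) ≤ ∏_{p∣W, p∣Δ}(p − ω(p)) ∏_{p∣W, p∤Δ}(p − ω(p) − 1)`
(`phiOmega_cons_le`) — the source of the saving `∏_{p∣W, p∤Δ_L}(1 − 1/(p − ω(p))) ≤ φ(W)/W · ∏_{p∣(W,Δ_L)} p/(p−1)`
against the factor `W/φ(W)` of `M/φ(M)` in the one-dimensional sieve (P94-SPEC §1b, §1g).

## References
* J. Maynard, *Dense clusters of primes in subsets*, Compositio Math. 152 (2016), proof of Prop. 9.4
  p. 26 [Maynard2016DenseClusters].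
* K. Ford, B. Green, S. Konyagin, J. Maynard, T. Tao, *Long gaps between primes*, JAMS 31 (2018),
  Thm 6 (7.14) p. 22 [FordGreenKonyaginMaynardTao2018].
-/

open Finset

namespace Literature.NumberTheory.Sieve.FGKMT2018

variable {k : ℕ}

/-- `ω⁺(p)` unfolded: the roots mod `p` of `L₀ · ∏_j L_j` are the roots of `L₀` together with the roots of
`∏_j L_j` (`p` prime). [cite: Maynard2016DenseClusters, §7 p. 13 (ω_𝓛(p)), proof of Prop. 9.4 p. 26] -/
theorem omegaL_cons_eq (L : Fin k → ℤ × ℤ) (l₀ : ℤ × ℤ) {p : ℕ} (hp : p.Prime) :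
    omegaL (Fin.cons l₀ L : Fin (k + 1) → ℤ × ℤ) p =
      #((Finset.range p).filter fun n : ℕ =>
        (p : ℤ) ∣ formEval l₀ n ∨ (p : ℤ) ∣ ∏ i, formEval (L i) n) := by
  classical
  unfold omegaL
  congr 1
  refine Finset.filter_congr fun n _ => ?_
  rw [Fin.prod_univ_succ]
  simp only [Fin.cons_zero, Fin.cons_succ]
  exact (Nat.prime_iff_prime_int.1 hp).dvd_mul

/-- `ω(p) ≤ ω⁺(p)`: every root of `∏_j L_j` is a root of `L₀ ∏_j L_j`.
[cite: Maynard2016DenseClusters, §7 p. 13, proof of Prop. 9.4 p. 26] -/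
theorem omegaL_le_omegaL_cons (L : Fin k → ℤ × ℤ) (l₀ : ℤ × ℤ) {p : ℕ} (hp : p.Prime) :
    omegaL L p ≤ omegaL (Fin.cons l₀ L : Fin (k + 1) → ℤ × ℤ) p := by
  classical
  rw [omegaL_cons_eq L l₀ hp]
  unfold omegaL
  exact Finset.card_le_card (Finset.monotone_filter_right _ fun n _ h => Or.inr h)

/-- A common root of `L₀ = a₀n + b₀` and `L_j = a_jn + b_j` mod `p` forces `p ∣ a₀b_j − a_jb₀`
(`a₀ L_j(n) − a_j L₀(n) = a₀b_j − a_jb₀`). [cite: Maynard2016DenseClusters, proof of Prop. 9.4 p. 26 (the factor Δ_L); FordGreenKonyaginMaynardTao2018, (7.14) p. 22] -/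
theorem dvd_resultant_of_common_root (l₀ l : ℤ × ℤ) {p : ℕ} {n : ℤ} (h₀ : (p : ℤ) ∣ formEval l₀ n)
    (h : (p : ℤ) ∣ formEval l n) : (p : ℤ) ∣ l₀.1 * l.2 - l.1 * l₀.2 := by
  have e : l₀.1 * l.2 - l.1 * l₀.2 = l₀.1 * formEval l n - l.1 * formEval l₀ n := by
    unfold formEval; ring
  rw [e]
  exact dvd_sub (h.mul_left _) (h₀.mul_left _)

/-- **`ω⁺(p) = ω(p) + 1` for `p ∤ Δ_L`**: if `p ∤ a₀` and `p ∤ a₀b_j − a_jb₀` for all `j`, then `L₀` has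
exactly one root mod `p` and it is not a root of any `L_j`.
[cite: Maynard2016DenseClusters, proof of Prop. 9.4 p. 26; FordGreenKonyaginMaynardTao2018, Thm 6 (7.14) p. 22] -/
theorem omegaL_cons_eq_succ (L : Fin k → ℤ × ℤ) (l₀ : ℤ × ℤ) {p : ℕ} (hp : p.Prime)
    (hpa : ¬ (p : ℤ) ∣ l₀.1) (hres : ∀ j, ¬ (p : ℤ) ∣ l₀.1 * (L j).2 - (L j).1 * l₀.2) :
    omegaL (Fin.cons l₀ L : Fin (k + 1) → ℤ × ℤ) p = omegaL L p + 1 := by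
  classical
  rw [omegaL_cons_eq L l₀ hp, Finset.filter_or, Finset.union_comm]
  have hdisj : Disjoint ((Finset.range p).filter fun n : ℕ => (p : ℤ) ∣ ∏ i, formEval (L i) n)
      ((Finset.range p).filter fun n : ℕ => (p : ℤ) ∣ formEval l₀ n) := by
    rw [Finset.disjoint_filter]
    intro n _ hprod h₀
    obtain ⟨j, -, hj⟩ := (Nat.prime_iff_prime_int.1 hp).exists_mem_finset_dvd hprod
    exact hres j (dvd_resultant_of_common_root l₀ (L j) h₀ hj)
  rw [Finset.card_union_of_disjoint hdisj]
  unfold omegaL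
  congr 1
  refine card_range_filter_dvd_formEval_eq_one l₀ hp.pos ?_
  rw [Int.gcd_eq_natAbs]
  simp only [Int.natAbs_natCast]
  exact (Nat.coprime_comm.1 ((Nat.Prime.coprime_iff_not_dvd hp).2 fun h => hpa (Int.natCast_dvd.2 h)))

/-- A prime not dividing `Δ_L = |a₀| ∏_j |a₀b_j − a_jb₀|` divides neither `a₀` nor any `a₀b_j − a_jb₀`.
[cite: FordGreenKonyaginMaynardTao2018, Thm 6 (7.14) p. 22 (definition of Δ_L)] -/
theorem not_dvd_of_not_dvd_discDelta (L : Fin k → ℤ × ℤ) (l₀ : ℤ × ℤ) {p : ℕ}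
    (h : ¬ p ∣ discDelta L l₀) :
    ¬ (p : ℤ) ∣ l₀.1 ∧ ∀ j, ¬ (p : ℤ) ∣ l₀.1 * (L j).2 - (L j).1 * l₀.2 := by
  unfold discDelta at h
  refine ⟨fun h' => h (dvd_mul_of_dvd_left (Int.natCast_dvd.1 h') _), fun j h' => h ?_⟩
  exact dvd_mul_of_dvd_right ((Int.natCast_dvd.1 h').trans
    (Finset.dvd_prod_of_mem (fun j => (l₀.1 * (L j).2 - (L j).1 * l₀.2).natAbs) (Finset.mem_univ j))) _

/-- **`φ_{ω⁺}(W) ≤ ∏_{p∣W, p∣Δ_L}(p − ω(p)) · ∏_{p∣W, p∤Δ_L}(p − ω(p) − 1)`**: the main-term density of the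
extended system gains a factor `1 − 1/(p − ω(p))` at every prime of `W` not dividing `Δ_L`.
[cite: Maynard2016DenseClusters, proof of Prop. 9.4 p. 26 (the final display, factor Δ_L/φ(Δ_L)); FordGreenKonyaginMaynardTao2018, Thm 6 (7.14) p. 22] -/
theorem phiOmega_cons_le (L : Fin k → ℤ × ℤ) (l₀ : ℤ × ℤ) (W : ℕ) :
    phiOmega (Fin.cons l₀ L : Fin (k + 1) → ℤ × ℤ) W ≤
      ∏ p ∈ W.primeFactors,
        (if p ∣ discDelta L l₀ then ((p : ℝ) - omegaL L p) else ((p : ℝ) - omegaL L p - 1)) := by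
  unfold phiOmega
  refine Finset.prod_le_prod (fun p hp => ?_) fun p hp => ?_
  · have := omegaL_le (Fin.cons l₀ L : Fin (k + 1) → ℤ × ℤ) p
    have : ((omegaL (Fin.cons l₀ L : Fin (k + 1) → ℤ × ℤ) p : ℕ) : ℝ) ≤ p := by exact_mod_cast this
    linarith
  · have hpP := Nat.prime_of_mem_primeFactors hp
    by_cases hΔ : p ∣ discDelta L l₀
    · rw [if_pos hΔ]
      have := omegaL_le_omegaL_cons L l₀ hpP
      have : ((omegaL L p : ℕ) : ℝ) ≤ (omegaL (Fin.cons l₀ L : Fin (k + 1) → ℤ × ℤ) p : ℕ) := by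
        exact_mod_cast this
      linarith
    · rw [if_neg hΔ]
      obtain ⟨hpa, hres⟩ := not_dvd_of_not_dvd_discDelta L l₀ hΔ
      rw [omegaL_cons_eq_succ L l₀ hpP hpa hres]
      push_cast
      linarith

/-- The gained factors against `p − ω(p)`: for `p ∣ W` with `ω(p) < p` (admissible `𝓛`),
`∏_{p∣W}(if p ∣ Δ then p − ω else p − ω − 1) = φ_ω(W) · ∏_{p∣W, p∤Δ}(1 − 1/(p − ω(p)))`.
[cite: Maynard2016DenseClusters, proof of Prop. 9.4 p. 26] -/
theorem prod_ite_sub_eq (L : Fin k → ℤ × ℤ) (hadm : FormsAdmissible L) (l₀ : ℤ × ℤ) (W : ℕ) :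
    ∏ p ∈ W.primeFactors,
        (if p ∣ discDelta L l₀ then ((p : ℝ) - omegaL L p) else ((p : ℝ) - omegaL L p - 1)) =
      phiOmega L W * ∏ p ∈ W.primeFactors.filter (fun p => ¬ p ∣ discDelta L l₀),
        (1 - 1 / ((p : ℝ) - omegaL L p)) := by
  classical
  unfold phiOmega
  rw [Finset.prod_filter, ← Finset.prod_mul_distrib]
  refine Finset.prod_congr rfl fun p hp => ?_
  have hpP := Nat.prime_of_mem_primeFactors hp
  have h0 : (0 : ℝ) < (p : ℝ) - omegaL L p := sub_omegaL_pos hadm hpP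
  split_ifs with h
  · ring
  · field_simp

/-- **`φ_{ω⁺}(W) ≤ φ_ω(W) · ∏_{p∣W, p∤Δ_L}(1 − 1/p)`** for admissible `𝓛` (`1 − 1/(p − ω) ≤ 1 − 1/p`).
[cite: Maynard2016DenseClusters, proof of Prop. 9.4 p. 26 (the final display); FordGreenKonyaginMaynardTao2018, Thm 6 (7.14) p. 22] -/
theorem phiOmega_cons_le_mul_prod {L : Fin k → ℤ × ℤ} (hadm : FormsAdmissible L) (l₀ : ℤ × ℤ) (W : ℕ) :
    phiOmega (Fin.cons l₀ L : Fin (k + 1) → ℤ × ℤ) W ≤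
      phiOmega L W * ∏ p ∈ W.primeFactors.filter (fun p => ¬ p ∣ discDelta L l₀), (1 - 1 / (p : ℝ)) := by
  classical
  refine (phiOmega_cons_le L l₀ W).trans ?_
  rw [prod_ite_sub_eq L hadm l₀ W]
  have hφ : 0 ≤ phiOmega L W := by
    unfold phiOmega
    exact Finset.prod_nonneg fun p hp =>
      (sub_omegaL_pos hadm (Nat.prime_of_mem_primeFactors hp)).le
  refine mul_le_mul_of_nonneg_left (Finset.prod_le_prod (fun p hp => ?_) fun p hp => ?_) hφ
  · have hpP := Nat.prime_of_mem_primeFactors (Finset.mem_filter.1 hp).1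
    have h0 : (1 : ℝ) ≤ (p : ℝ) - omegaL L p := by
      have : omegaL L p < p := ((formsAdmissible_iff_omegaL L).1 hadm).2 p hpP
      have : omegaL L p + 1 ≤ p := this
      have : ((omegaL L p : ℕ) : ℝ) + 1 ≤ p := by exact_mod_cast this
      linarith
    rw [sub_nonneg, div_le_one (by linarith)]
    exact h0
  · have hpP := Nat.prime_of_mem_primeFactors (Finset.mem_filter.1 hp).1
    have hω0 : (0 : ℝ) ≤ (omegaL L p : ℕ) := Nat.cast_nonneg _
    have h0 : (0 : ℝ) < (p : ℝ) - omegaL L p := sub_omegaL_pos hadm hpP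
    have hp0 : (0 : ℝ) < p := by exact_mod_cast hpP.pos
    have : 1 / (p : ℝ) ≤ 1 / ((p : ℝ) - omegaL L p) :=
      one_div_le_one_div_of_le h0 (by linarith)
    linarith

end Literature.NumberTheory.Sieve.FGKMT2018
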